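import Mathlib
import Summits.NavierStokesRegularity.NavierStokesRegularity.Theorems.ThreadingFluxHorizonTowerDefs
import Summits.NavierStokesRegularity.NavierStokesRegularity.Theorems.ThreadingFluxHorizonTowerTwoShellHorizonByName
import Summits.NavierStokesRegularity.NavierStokesRegularity.Theorems.ThreadingFluxHorizonTowerOrderOneSphereEuler
import Summits.NavierStokesRegularity.NavierStokesRegularity.Theorems.ThreadingFluxHorizonTowerProfileFormulas
import Summits.NavierStokesRegularity.NavierStokesRegularity.Theorems.ThreadingFluxHorizonTowerProfileCore
import Summits.NavierStokesRegularity.NavierStokesRegularity.Theorems.ThreadingFluxHorizonTowerTailRung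
import Summits.NavierStokesRegularity.NavierStokesRegularity.Theorems.ThreadingFluxHorizonTowerZonalForm
import Literature.Analysis.FluidPDE.VorticityCalculus
import HarnessLib

/-!
# Crux `PoloidalLiouville` (stmt-NavierStokesRegularity-1222), crux idea «horizon-threading-tower» (ns-idea-15):
# THE FINITE-TOWER ORDER-ONE BRIDGE — `𝔏₁` of a finite scale-free tower is a weighted sum of shell brackets

Support file (`--supports stmt-NavierStokesRegularity-1222`, helper; cell `ns-wall-extremal`, width hand ns-wall-eng-3 g3; 0 kit).

For a FINITE scale-free tower `U = Σ_{l ∈ K} U_{H_l}`, `U_H = horizonProfile l H 0` (`K ⊂ ℕ` finite, `l ≥ 1`, `H_l` smooth,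
`l`-homogeneous, harmonic), `orderOneSphereEuler` with `f = Σ l(l+1) H_l/rˡ`, `Φ = Σ 2H_l/rˡ` gives, for `x ≠ 0`,

  `𝔏₁[U](x) = −‖x‖ · Σ_{j,k ∈ K} 2·j(j+1) (‖x‖²)^{−j/2} (‖x‖²)^{−k/2} ⟪x, ∇H_j(x) × ∇H_k(x)⟫`   (★ `horizonL1_finiteTower`)

(ordered double sum; antisymmetry of the bracket turns it into `Σ_{j<k} 2(j(j+1) − k(k+1))(…)⟪x, ∇H_j × ∇H_k⟫`).  So the order-one
horizon law of a finite tower is PURE POLYNOMIAL ALGEBRA in the shells — the input a successor needs for «finite towers at order one»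
(two shells: `twoShellHorizonTowerZonality`, p691920; ≥ 3 shells: OPEN, see the cell note `TwoShellTowers-RESULTS.md` §4).

HONEST LABEL: vector calculus about one crux idea's typed objects; no Prop of the sketch is closed by this file;
`HorizonTowerZonality` (general towers), `PoloidalLiouville` (1222) OPEN; NS regularity NOT proved.
-/

-- the summit and its single sub-problem share the name (CONVENTIONS §1)
set_option linter.dupNamespace false

noncomputable section

namespace Summit.NavierStokesRegularity.NavierStokesRegularity.Theorems.PoloidalLiouville.HorizonTower

open Set Function Filter Topology Metric
open scoped Topology RealInnerProductSpace Laplacian ContDiff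
open Literature.Analysis.FluidPDE
open Literature.Geometry.DiscreteGeometry (inner_fin3)

section FiniteTower

/-- The triple product kills the radial parts: `⟪x, (a·g + α·x) × (b·g' + β·x)⟫ = a b ⟪x, g × g'⟫`. -/
theorem inner_cross_smul_add_smul_self (x g g' : E3) (a α b β : ℝ) :
    ⟪x, cross (a • g + α • x) (b • g' + β • x)⟫ = a * b * ⟪x, cross g g'⟫ := by
  obtain ⟨p0, p1, p2⟩ := cross_fin3 (a • g + α • x) (b • g' + β • x)
  obtain ⟨q0, q1, q2⟩ := cross_fin3 g g'
  rw [inner_fin3, inner_fin3, p0, p1, p2, q0, q1, q2]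
  simp only [PiLp.add_apply, PiLp.smul_apply, smul_eq_mul]
  ring

/-- `Δ` of a finite sum of `C²` functions at a point. -/
theorem laplacian_finset_sum {ι : Type*} (s : Finset ι) (g : ι → E3 → ℝ) {x : E3}
    (hg : ∀ i ∈ s, ContDiffAt ℝ 2 (g i) x) :
    Laplacian.laplacian (fun z => ∑ i ∈ s, g i z) x = ∑ i ∈ s, Laplacian.laplacian (g i) x := by
  classical
  induction s using Finset.induction_on with
  | empty =>
    simp only [Finset.sum_empty]
    have h0 : (fun _ : E3 => (0 : ℝ)) = (0 : E3 → ℝ) := rfl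
    rw [h0]
    have := InnerProductSpace.laplacian_smul (0 : ℝ) (contDiffAt_const (c := (0 : ℝ)) (x := x))
    simpa using this
  | insert a s ha ih =>
    have hga : ContDiffAt ℝ 2 (g a) x := hg a (Finset.mem_insert_self a s)
    have hgs : ∀ i ∈ s, ContDiffAt ℝ 2 (g i) x := fun i hi => hg i (Finset.mem_insert_of_mem hi)
    have hsum : ContDiffAt ℝ 2 (fun z => ∑ i ∈ s, g i z) x := ContDiffAt.sum fun i hi => hgs i hi
    have hfun : (fun z => ∑ i ∈ insert a s, g i z) = (g a) + fun z => ∑ i ∈ s, g i z := by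
      funext z; simp [Finset.sum_insert ha]
    rw [hfun, hga.laplacian_add hsum, ih hgs, Finset.sum_insert ha]

variable (K : Finset ℕ) (H : ℕ → E3 → ℝ)

/-- ★ **THE FINITE-TOWER ORDER-ONE BRIDGE.**  For a finite scale-free tower of horizon profiles of smooth homogeneous harmonic
shells `H_l` (`l ∈ K`, `l ≥ 1`) and `x ≠ 0`:
`𝔏₁[Σ U_{H_l}](x) = −‖x‖ Σ_{j,k∈K} 2 j(j+1) (‖x‖²)^{−j/2}(‖x‖²)^{−k/2} ⟪x, ∇H_j(x) × ∇H_k(x)⟫`. -/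
theorem horizonL1_finiteTower (hK : ∀ l ∈ K, 1 ≤ l) (hH : ∀ l ∈ K, ContDiff ℝ (⊤ : ℕ∞) (H l))
    (hhom : ∀ l ∈ K, ∀ (c : ℝ) (y : E3), H l (c • y) = c ^ l * H l y)
    (hharm : ∀ l ∈ K, ∀ y, Laplacian.laplacian (H l) y = 0) {x : E3} (hx : x ≠ 0) :
    horizonL1 (fun z => ∑ l ∈ K, horizonProfile l (H l) 0 z) 0 x
      = -‖x‖ * ∑ j ∈ K, ∑ k ∈ K,
          2 * ((j * (j + 1) : ℝ)) * (‖x‖ ^ 2) ^ (-(j : ℝ) / 2) * (‖x‖ ^ 2) ^ (-(k : ℝ) / 2)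
            * ⟪x, cross (gradient (H j) x) (gradient (H k) x)⟫ := by
  classical
  -- the data of `OrderOneSphereEuler`
  set U : E3 → E3 := fun z => ∑ l ∈ K, horizonProfile l (H l) 0 z with hU
  set f : E3 → ℝ := fun z => ∑ l ∈ K, (l * (l + 1) : ℝ) * H l z / ‖z‖ ^ l with hf
  set Φ : E3 → ℝ := fun z => ∑ l ∈ K, 2 * H l z / ‖z‖ ^ l with hΦ
  have hUl : ∀ l ∈ K, ∀ {z : E3}, z ≠ 0 → ContDiffAt ℝ (⊤ : ℕ∞) (horizonProfile l (H l) 0) z :=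
    fun l hl z hz => contDiffAt_horizonProfile (hK l hl) (hH l hl) (hhom l hl) (hharm l hl) hz
  have hUld : ∀ l ∈ K, ∀ {z : E3}, z ≠ 0 → DifferentiableAt ℝ (horizonProfile l (H l) 0) z :=
    fun l hl z hz => (hUl l hl hz).differentiableAt (by simp)
  -- (1) smoothness off the centre
  have h1 : ContDiffOn ℝ (⊤ : ℕ∞) U {(0 : E3)}ᶜ := fun z hz =>
    (ContDiffAt.sum fun l hl => hUl l hl (by simpa using hz)).contDiffWithinAt
  have h2 : ContDiffOn ℝ (⊤ : ℕ∞) Φ {(0 : E3)}ᶜ := fun z hz =>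
    (ContDiffAt.sum fun l hl => contDiffAt_const_mul_div_norm_pow (hH l hl) 2 (by simpa using hz) le_rfl).contDiffWithinAt
  -- (2) degree-0 homogeneity
  have h3 : IsZeroHomogeneousAbout 0 U := by
    intro c hc y
    simp only [hU]
    exact Finset.sum_congr rfl fun l hl => isZeroHomogeneousAbout_horizonProfile (hK l hl) (hH l hl) (hhom l hl) c hc y
  have h4 : ∀ c : ℝ, 0 < c → ∀ y : E3, Φ (0 + c • y) = Φ (0 + y) := by
    intro c hc y
    simp only [hΦ, zero_add]
    exact Finset.sum_congr rfl fun l hl => const_mul_div_norm_pow_smul (hhom l hl) 2 hc y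
  -- (3) divergence free and unthreaded off the centre
  have h5 : ∀ z : E3, z ≠ 0 → VectorCalculus.divergence U z = 0 := by
    intro z hz
    have hadd : VectorCalculus.divergence U z = ∑ l ∈ K, VectorCalculus.divergence (horizonProfile l (H l) 0) z := by
      simp only [hU, VectorCalculus.divergence]
      rw [fderiv_fun_sum fun l hl => hUld l hl hz, ContinuousLinearMap.toLinearMap_sum, map_sum]
    rw [hadd]
    exact Finset.sum_eq_zero fun l hl => divergence_horizonProfile (hK l hl) (hH l hl) hz
  have h6 : ∀ z : E3, z ≠ 0 → ⟪curl U z, z - 0⟫ = 0 := by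
    intro z hz
    have hcurl : curl U z = ∑ l ∈ K, curl (horizonProfile l (H l) 0) z := by
      rw [curl_eq_curlCLM, hU, fderiv_fun_sum fun l hl => hUld l hl hz, map_sum]
      exact Finset.sum_congr rfl fun l _ => (curl_eq_curlCLM _ _).symm
    rw [sub_zero, hcurl, sum_inner]
    exact Finset.sum_eq_zero fun l hl => inner_curl_horizonProfile (hK l hl) (hH l hl) (hhom l hl) hz
  -- (4) the radial part and the tangential potential
  have h7 : ∀ z : E3, z ≠ 0 → f z = ⟪U z, z - 0⟫ / ‖z - 0‖ := by
    intro z hz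
    rw [sub_zero, hU]
    simp only [hf]
    rw [sum_inner, Finset.sum_div]
    exact Finset.sum_congr rfl fun l hl =>
      (inner_horizonProfile_self_div_norm (hK l hl) (hH l hl) (hhom l hl) (hharm l hl) hz).symm
  have h8 : ∀ z : E3, z ≠ 0 → ‖z - 0‖ ^ 2 * Laplacian.laplacian Φ z = -2 * f z := by
    intro z hz
    have cl : ∀ l ∈ K, ContDiffAt ℝ 2 (fun w : E3 => 2 * H l w / ‖w‖ ^ l) z := fun l hl =>
      contDiffAt_const_mul_div_norm_pow (hH l hl) 2 hz (by norm_cast)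
    rw [sub_zero, hΦ, laplacian_finset_sum K (fun l => fun w : E3 => 2 * H l w / ‖w‖ ^ l) cl, Finset.mul_sum]
    simp only [hf]
    rw [Finset.mul_sum]
    exact Finset.sum_congr rfl fun l hl => by
      rw [laplacian_tangentialPotential (hH l hl) (hhom l hl) (hharm l hl) hz, neg_mul]
  -- (5) the order-one law as a bracket
  have hSE := orderOneSphereEuler U f Φ 0 h1 h2 h3 h4 h5 h6 h7 h8 x hx
  rw [sub_zero] at hSE
  rw [hSE]
  congr 1
  -- the two gradients
  have hdl : ∀ l ∈ K, ∀ c : ℝ, DifferentiableAt ℝ (fun z : E3 => c * H l z / ‖z‖ ^ l) x := fun l hl c =>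
    (contDiffAt_const_mul_div_norm_pow (hH l hl) c hx (n := 1) (by norm_cast)).differentiableAt (by simp)
  have hgf : gradient f x = ∑ l ∈ K, gradient (fun z : E3 => (l * (l + 1) : ℝ) * H l z / ‖z‖ ^ l) x := by
    apply ext_inner_right ℝ; intro v
    rw [sum_inner, Literature.Analysis.FluidPDE.inner_gradient_left, hf, fderiv_fun_sum fun l hl => hdl l hl _,
      FunLike.coe_sum, Finset.sum_apply]
    exact Finset.sum_congr rfl fun l _ => (Literature.Analysis.FluidPDE.inner_gradient_left _ _ _).symm
  have hgΦ : gradient Φ x = ∑ l ∈ K, gradient (fun z : E3 => 2 * H l z / ‖z‖ ^ l) x := by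
    apply ext_inner_right ℝ; intro v
    rw [sum_inner, Literature.Analysis.FluidPDE.inner_gradient_left, hΦ, fderiv_fun_sum fun l hl => hdl l hl _,
      FunLike.coe_sum, Finset.sum_apply]
    exact Finset.sum_congr rfl fun l _ => (Literature.Analysis.FluidPDE.inner_gradient_left _ _ _).symm
  -- bilinearity of the cross product over the two finite sums
  have hbil : ∀ (a b : ℕ → E3), cross (∑ j ∈ K, a j) (∑ k ∈ K, b k) = ∑ j ∈ K, ∑ k ∈ K, cross (a j) (b k) := by
    intro a b
    rw [← crossCLM_apply, map_sum, Finset.sum_comm]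
    refine Finset.sum_congr rfl fun k _ => ?_
    rw [map_sum crossCLM a K, FunLike.coe_sum, Finset.sum_apply]
    rfl
  rw [hgf, hgΦ, hbil, inner_sum]
  refine Finset.sum_congr rfl fun j hj => ?_
  rw [inner_sum]
  refine Finset.sum_congr rfl fun k hk => ?_
  rw [gradient_const_mul_div_norm_pow (hH j hj) _ hx, gradient_const_mul_div_norm_pow (hH k hk) _ hx,
    inner_cross_smul_add_smul_self]
  ring

/-- The same with the double sum ANTISYMMETRISED: only pairs of different degrees contribute, with weight
`j(j+1) − k(k+1)`:  `𝔏₁[Σ U_{H_l}](x) = −‖x‖ Σ_{j,k∈K} (j(j+1) − k(k+1)) (‖x‖²)^{−j/2}(‖x‖²)^{−k/2} ⟪x, ∇H_j × ∇H_k⟫`. -/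
theorem horizonL1_finiteTower_antisym (hK : ∀ l ∈ K, 1 ≤ l) (hH : ∀ l ∈ K, ContDiff ℝ (⊤ : ℕ∞) (H l))
    (hhom : ∀ l ∈ K, ∀ (c : ℝ) (y : E3), H l (c • y) = c ^ l * H l y)
    (hharm : ∀ l ∈ K, ∀ y, Laplacian.laplacian (H l) y = 0) {x : E3} (hx : x ≠ 0) :
    horizonL1 (fun z => ∑ l ∈ K, horizonProfile l (H l) 0 z) 0 x
      = -‖x‖ * ∑ j ∈ K, ∑ k ∈ K,
          (((j * (j + 1) : ℝ)) - (k * (k + 1) : ℝ)) * (‖x‖ ^ 2) ^ (-(j : ℝ) / 2) * (‖x‖ ^ 2) ^ (-(k : ℝ) / 2)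
            * ⟪x, cross (gradient (H j) x) (gradient (H k) x)⟫ := by
  rw [horizonL1_finiteTower K H hK hH hhom hharm hx]
  congr 1
  -- antisymmetry of the bracket: `⟪x, g × g'⟫ = −⟪x, g' × g⟫`
  have hanti : ∀ g g' : E3, ⟪x, cross g g'⟫ = -⟪x, cross g' g⟫ := by
    intro g g'
    obtain ⟨p0, p1, p2⟩ := cross_fin3 g g'
    obtain ⟨q0, q1, q2⟩ := cross_fin3 g' g
    rw [inner_fin3, inner_fin3, p0, p1, p2, q0, q1, q2]; ring
  set w : ℕ → ℕ → ℝ := fun j k =>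
    (‖x‖ ^ 2) ^ (-(j : ℝ) / 2) * (‖x‖ ^ 2) ^ (-(k : ℝ) / 2) * ⟪x, cross (gradient (H j) x) (gradient (H k) x)⟫ with hw
  have hwanti : ∀ j k, w k j = -w j k := by
    intro j k; simp only [hw]; rw [hanti (gradient (H k) x) (gradient (H j) x)]; ring
  have hL : ∑ j ∈ K, ∑ k ∈ K, 2 * ((j * (j + 1) : ℝ)) * (‖x‖ ^ 2) ^ (-(j : ℝ) / 2) * (‖x‖ ^ 2) ^ (-(k : ℝ) / 2)
        * ⟪x, cross (gradient (H j) x) (gradient (H k) x)⟫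
      = ∑ j ∈ K, ∑ k ∈ K, 2 * ((j * (j + 1) : ℝ)) * w j k := by
    refine Finset.sum_congr rfl fun j _ => Finset.sum_congr rfl fun k _ => ?_
    simp only [hw]; ring
  have hR : ∑ j ∈ K, ∑ k ∈ K, (((j * (j + 1) : ℝ)) - (k * (k + 1) : ℝ)) * (‖x‖ ^ 2) ^ (-(j : ℝ) / 2)
        * (‖x‖ ^ 2) ^ (-(k : ℝ) / 2) * ⟪x, cross (gradient (H j) x) (gradient (H k) x)⟫
      = ∑ j ∈ K, ∑ k ∈ K, ((j * (j + 1) : ℝ)) * w j k - ∑ j ∈ K, ∑ k ∈ K, ((k * (k + 1) : ℝ)) * w j k := by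
    rw [← Finset.sum_sub_distrib]
    refine Finset.sum_congr rfl fun j _ => ?_
    rw [← Finset.sum_sub_distrib]
    refine Finset.sum_congr rfl fun k _ => ?_
    simp only [hw]; ring
  have hswap : ∑ j ∈ K, ∑ k ∈ K, ((k * (k + 1) : ℝ)) * w j k = -∑ j ∈ K, ∑ k ∈ K, ((j * (j + 1) : ℝ)) * w j k := by
    rw [Finset.sum_comm]
    rw [← Finset.sum_neg_distrib]
    refine Finset.sum_congr rfl fun j _ => ?_
    rw [← Finset.sum_neg_distrib]
    refine Finset.sum_congr rfl fun k _ => ?_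
    rw [hwanti k j]; ring
  rw [hL, hR, hswap]
  rw [sub_neg_eq_add, ← two_mul, Finset.mul_sum]
  refine Finset.sum_congr rfl fun j _ => ?_
  rw [Finset.mul_sum]
  refine Finset.sum_congr rfl fun k _ => ?_
  ring

end FiniteTower

end Summit.NavierStokesRegularity.NavierStokesRegularity.Theorems.PoloidalLiouville.HorizonTower

end
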